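import Summits.HubbardSuperconductivity.HubbardSuperconductivity.Theorems.AnisotropyChordTransferFibre3KT2bRow
import Summits.HubbardSuperconductivity.HubbardSuperconductivity.Theorems.AnisotropyChordTransferFibre3TtailBounds
import Summits.HubbardSuperconductivity.HubbardSuperconductivity.Theorems.AnisotropyChordTransferFibre3Delta3Bound
import Summits.HubbardSuperconductivity.HubbardSuperconductivity.Theorems.AnisotropyChordTransferFibre3Lam2Small
import Summits.HubbardSuperconductivity.HubbardSuperconductivity.Theorems.AnisotropyChordTransferFibre3PhiHatClosed
import Summits.HubbardSuperconductivity.HubbardSuperconductivity.Theorems.AnisotropyChordTransferFibre3PlaneWave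

/-!
# Route `AnisotropyChord` / H0 rotor rung: PartN41-C §3 — `LapNormNamed` PROVED (`‖T₀s‖²` named by Parseval)

Theory-1 g22's PartN41-C §3 `LapNormNamed` (port …Fibre3KT2bRow): with `(T₀s)(a) = ½Σ_e (s(a) − s(a − e))`,
★ `‖T₀s‖² = (c_s²/4V)·Σ_{k≠0} (1 + λ₂g(k))²` for the ground profile (`L ≥ 5`, `0 ≤ Δ < 1`):
`FT[T₀s](k) = ½Σ_e(1 − e^{−ik·e})ŝ(k) = ε(k)ŝ(k)` (`dft_shift_sub`, `sum_phase_nn`), `ŝ(k) = c_s g(k)` off `k = 0`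
(`dft_sfun'`), `ε g = ½(1 + λ₂ g)`, and Parseval (`normSq_dft_sum`).  ★ `RowC.lapNorm_named`, ★ `lapNormNamed_holds (Δ) :
LapNormNamed L Δ`.
Prover seat `hubbard-h0-rotor-p1` g27 (route lead); helper for stmt-HubbardSuperconductivity-23918 (`--supports`, helper class).
WHAT THIS IS NOT: nothing here proves superconductivity in the Hubbard model; a named form of one input of ONE row of ONE
conditional reduction.  Tree imports only; no new definitions; no sorry, no axioms.
-/

set_option linter.dupNamespace false
set_option autoImplicit false

noncomputable section

open scoped BigOperators

namespace Summit.HubbardSuperconductivity.HubbardSuperconductivity.Theorems.AnisotropyChord.Transfer.Fibre3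

variable (L : ℕ) [NeZero L]

namespace RowC

omit [NeZero L] in
/-- the two copies of `s` in the tree agree. [folklore] -/
theorem sfun'_eq_sfun (Δ : ℝ) (f : Tor L → ℝ) : sfun' L Δ f = sfun L Δ f := rfl

/-- `Σ_e conj φ_k(e) = 4 − 2ε(k)` over the four nearest neighbours. [folklore] -/
theorem nn_sum_zPh (k : Tor L) :
    zPh L k (ex L) + zPh L k (-ex L) + zPh L k (ey L) + zPh L k (-ey L) = ((4 - 2 * epsT L k : ℝ) : ℂ) := by
  unfold zPh
  rw [← map_add, ← map_add, ← map_add, sum_phase_nn, Complex.conj_ofReal]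

/-- `FT[T₀s](k) = ε(k)·ŝ(k)`. [folklore] -/
theorem dft_T0 (Δ : ℝ) (f : Tor L → ℝ) (k : Tor L) :
    dft L (fun a => ((nnList L).map (fun e => sfun L Δ f a - sfun L Δ f (a - e))).sum / 2) k
      = ((epsT L k : ℝ) : ℂ) * dft L (sfun L Δ f) k := by
  have hs : ∀ e : Tor L, dft L (fun a => sfun L Δ f (a - e)) k = zPh L k e * dft L (sfun L Δ f) k :=
    fun e => OuterMaj.dft_shift_sub L (sfun L Δ f) k e
  -- linearity of `dft`, written out on the summands
  have e1 : dft L (fun a => ((nnList L).map (fun e => sfun L Δ f a - sfun L Δ f (a - e))).sum / 2) k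
      = (4 * dft L (sfun L Δ f) k - (dft L (fun a => sfun L Δ f (a - ex L)) k
          + dft L (fun a => sfun L Δ f (a - -ex L)) k + dft L (fun a => sfun L Δ f (a - ey L)) k
          + dft L (fun a => sfun L Δ f (a - -ey L)) k)) / 2 := by
    unfold dft
    rw [Finset.mul_sum, ← Finset.sum_add_distrib, ← Finset.sum_add_distrib, ← Finset.sum_add_distrib,
      ← Finset.sum_sub_distrib, Finset.sum_div]
    refine Finset.sum_congr rfl fun a _ => ?_
    simp only [nnList_map_sum]
    push_cast
    ring
  rw [e1, hs, hs, hs, hs]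
  have h4 := nn_sum_zPh L k
  have e2 : (4 : ℂ) * dft L (sfun L Δ f) k
      - (zPh L k (ex L) * dft L (sfun L Δ f) k + zPh L k (-ex L) * dft L (sfun L Δ f) k
        + zPh L k (ey L) * dft L (sfun L Δ f) k + zPh L k (-ey L) * dft L (sfun L Δ f) k)
      = (4 - (zPh L k (ex L) + zPh L k (-ex L) + zPh L k (ey L) + zPh L k (-ey L))) * dft L (sfun L Δ f) k := by ring
  rw [e2, h4]
  push_cast
  ring

/-- ★ `‖T₀s‖² = (c_s²/4V)·Σ_{k≠0}(1 + λ₂g(k))²` (body of `LapNormNamed L Δ`). [folklore] -/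
theorem lapNorm_named (hL : 5 ≤ L) {Δ lam2 : ℝ} (hΔ0 : 0 ≤ Δ) {f : Tor L → ℝ}
    (hf : IsGroundTwoMagnon L Δ lam2 f) :
    lapNormSq L Δ f = cS L Δ lam2 f ^ 2 / (4 * (L : ℝ) ^ 2)
      * ∑ k ∈ (Finset.univ : Finset (Tor L)).erase 0, (1 + lam2 * gres L lam2 k) ^ 2 := by
  classical
  have hV : (0 : ℝ) < (L : ℝ) ^ 2 := by
    have : (0 : ℝ) < L := by exact_mod_cast (show 0 < L by omega)
    positivity
  have hl2 := lam2_lt_two_eps1 L hL hΔ0 hf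
  set u : Tor L → ℝ := fun a => ((nnList L).map (fun e => sfun L Δ f a - sfun L Δ f (a - e))).sum / 2 with hu
  have hP := normSq_dft_sum L u
  -- `|û(k)|² = ε² |ŝ|²`, named
  have hk : ∀ k : Tor L, Complex.normSq (dft L u k)
      = if k = 0 then 0 else cS L Δ lam2 f ^ 2 / 4 * (1 + lam2 * gres L lam2 k) ^ 2 := by
    intro k
    rw [hu, dft_T0 L Δ f k, ← sfun'_eq_sfun, dft_sfun' L (by omega) hf.1 hl2 k, ← Complex.ofReal_mul,
      Complex.normSq_ofReal]
    by_cases hk0 : k = 0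
    · rw [if_pos hk0, if_pos hk0, hk0, epsT_zero]; ring
    · rw [if_neg hk0, if_neg hk0]
      have hc : 0 < 2 * epsT L k - lam2 := by have := eps1_le_epsT L (by omega) hk0; linarith
      unfold gres
      rw [if_neg hk0]
      have key : epsT L k * (cS L Δ lam2 f / (2 * epsT L k - lam2))
          = cS L Δ lam2 f / 2 * (1 + lam2 * (1 / (2 * epsT L k - lam2))) := by
        have hinv : (2 * epsT L k - lam2) * (2 * epsT L k - lam2)⁻¹ = 1 := mul_inv_cancel₀ hc.ne'
        linear_combination (cS L Δ lam2 f / 2) * hinv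
      rw [key]
      ring
  rw [Finset.sum_congr rfl fun k _ => hk k, Finset.sum_ite, Finset.sum_const_zero, zero_add,
    Finset.filter_ne', ← Finset.mul_sum] at hP
  have hlap : lapNormSq L Δ f = ∑ a : Tor L, u a ^ 2 := rfl
  rw [hlap]
  field_simp
  linarith

end RowC

/-- ★ **`LapNormNamed L Δ` holds.** [folklore] -/
theorem lapNormNamed_holds (Δ : ℝ) : LapNormNamed L Δ :=
  fun _ _ hL hΔ0 _ hf => RowC.lapNorm_named L hL hΔ0 hf

end Summit.HubbardSuperconductivity.HubbardSuperconductivity.Theorems.AnisotropyChord.Transfer.Fibre3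

end
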